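import Literature.NumberTheory.LFunctions.FeketePolyaKernelCertificatesBlockWrappers
import HarnessLib

/-!
# No real zero for real primitive characters of conductor `9677 ≤ q ≤ 10067`: the Fekete–Pólya rows, in the kernel (rows deferred by the earlier engines)

Topic `Literature/NumberTheory/LFunctions`; namespace `Literature.NumberTheory.LFunctions`. THEOREMS only (no
definition, no named fact, no `sorry`; standard axioms): one PUBLIC theorem **`noRealZero{Odd,Even}_fp_<q>`** per
fundamental discriminant `D`, `|D| = q ∈ [9677, 10067]`, that admits a Fekete–Pólya witness but was DEFERRED by the per-position engines v1/v2 (walk too long for one `decide`) — for every primitive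
quadratic `χ` mod `q` of the parity of `D` and every `σ ∈ (0, 1)`, `L(σ, χ) ≠ 0` (statement shape of the
`interval_cases` bullets of the `NoRealZero{Odd,Even}…` range files, so a range assembly cites them by name).
Cell `parity-realchar`, kernel floor of the wide column (TARGET §2 row 19), Fekete–Pólya lane (seat prover-2).

Method (engine v4): `FeketePolyaKernelCertificatesBlock{,Wrappers}.lean` — the iterated partial sums of order
`K` of the induced character `χ↑(q·w)` are non-negative over one period, decided in the kernel BLOCKWISE on packed
base-`2^b` digits (`blockCert b B K (q·w) (tabs… b ps q w)`: sign tables of the character from the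
quadratic-residue bitsets of the prime factors of the conductor — the factor list is part of each certificate,
primality by `norm_num` — prefix sums by one big-integer multiplication per order and block, sign test by one
AND), hence `ℜL(σ, χ↑(q·w)) > 0` (Fekete–Pólya 1912 / MV §11.2.1 Exercise 7) and `L(σ, χ) ≠ 0` (positive Euler
factors, Exercise 8).  Witnesses `(w, K)` = the cheapest in the exact integer scan of this seat
(`HOME/parity-realchar-prover-2/fp-witnesses-*.tsv`; no kit); the digit width `b` is two bits above the size of
the running-sum bound recorded by the scan.  12 characters in this file (est. 80 kernel-s).
NOT covered here (no Fekete–Pólya witness with `w ≤ 40`, `q·w ≤ 4·10⁵`, `K ≤ 12`; the other Fekete–Pólya rows of this range are in the `NoRealZeroFeketePolyaX…` files) — left to the truncation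
certificates of the companion lane: see those files.

## References

* H. L. Montgomery, R. C. Vaughan, *Multiplicative Number Theory I*, CUP 2007, §9.3 Thm 9.13, §11.2.1
  Exercises 7–8. [MontgomeryVaughan2007]
* M. Fekete, G. Pólya, *Über ein Problem von Laguerre*, Rend. Circ. Mat. Palermo 34 (1912) 89–120. [FeketePolya1912]
-/

namespace Literature.NumberTheory.LFunctions

open FeketePolyaKernel

set_option maxHeartbeats 400000 in
/-- `D = 9677`: the even character `(·/9677)` of conductor `9677` (`9677`: prime) — Fekete–Pólya witness of order `5` along the induced modulus `9677·35 = 338695`, block certificate (digits of `75` bits, splitting depth `11`); est. `8.6` kernel-s. [cite: MontgomeryVaughan2007, §11.2.1 Exercises 7 (g), 8] -/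
theorem noRealZeroEven_fp_9677 :
    ∀ χ : DirichletCharacter ℂ 9677, χ.IsQuadratic → χ.IsPrimitive → χ.Even →
      ∀ σ : ℝ, 0 < σ → σ < 1 → χ.LFunction σ ≠ 0 :=
  good_even_of_odd_blk [9677] (by norm_num) (by decide) (by decide) 35 5 75 11 (by decide) (by decide) (by decide)
    (Or.inr (by decide +kernel))

set_option maxHeartbeats 400000 in
/-- `D = -9691`: the odd character `(·/9691)` of conductor `9691` (`9691`: 11 · 881) — Fekete–Pólya witness of order `5` along the induced modulus `9691·26 = 251966`, block certificate (digits of `76` bits, splitting depth `10`); est. `6.1` kernel-s. [cite: MontgomeryVaughan2007, §11.2.1 Exercises 7 (g), 8] -/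
theorem noRealZeroOdd_fp_9691 :
    ∀ χ : DirichletCharacter ℂ 9691, χ.IsQuadratic → χ.IsPrimitive → χ.Odd →
      ∀ σ : ℝ, 0 < σ → σ < 1 → χ.LFunction σ ≠ 0 :=
  good_odd_of_odd_blk [11, 881] (by norm_num) (by decide) (by decide) 26 5 76 10 (by decide) (by decide) (by decide)
    (Or.inr (by decide +kernel))

set_option maxHeartbeats 400000 in
/-- `D = -9707`: the odd character `(·/9707)` of conductor `9707` (`9707`: 17 · 571) — Fekete–Pólya witness of order `5` along the induced modulus `9707·22 = 213554`, block certificate (digits of `75` bits, splitting depth `10`); est. `5.1` kernel-s. [cite: MontgomeryVaughan2007, §11.2.1 Exercises 7 (g), 8] -/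
theorem noRealZeroOdd_fp_9707 :
    ∀ χ : DirichletCharacter ℂ 9707, χ.IsQuadratic → χ.IsPrimitive → χ.Odd →
      ∀ σ : ℝ, 0 < σ → σ < 1 → χ.LFunction σ ≠ 0 :=
  good_odd_of_odd_blk [17, 571] (by norm_num) (by decide) (by decide) 22 5 75 10 (by decide) (by decide) (by decide)
    (Or.inr (by decide +kernel))

set_option maxHeartbeats 400000 in
/-- `D = -9748`: the odd character `χ₋₄·(·/2437)` of conductor `9748` (`2437`: prime) — Fekete–Pólya witness of order `7` along the induced modulus `9748·35 = 341180`, block certificate (digits of `109` bits, splitting depth `11`); est. `12.6` kernel-s. [cite: MontgomeryVaughan2007, §11.2.1 Exercises 7 (g), 8] -/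
theorem noRealZeroOdd_fp_9748 :
    ∀ χ : DirichletCharacter ℂ 9748, χ.IsQuadratic → χ.IsPrimitive → χ.Odd →
      ∀ σ : ℝ, 0 < σ → σ < 1 → χ.LFunction σ ≠ 0 :=
  good_odd_of_four_blk [2437] (by norm_num) (by decide) (by decide) 35 7 109 11 (by decide) (by decide) (by decide)
    (Or.inr (by decide +kernel))

set_option maxHeartbeats 400000 in
/-- `D = -9816`: the odd character `χ₈·(·/1227)` of conductor `9816` (`1227`: 3 · 409) — Fekete–Pólya witness of order `7` along the induced modulus `9816·17 = 166872`, block certificate (digits of `103` bits, splitting depth `10`); est. `6.0` kernel-s. [cite: MontgomeryVaughan2007, §11.2.1 Exercises 7 (g), 8] -/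
theorem noRealZeroOdd_fp_9816 :
    ∀ χ : DirichletCharacter ℂ 9816, χ.IsQuadratic → χ.IsPrimitive → χ.Odd →
      ∀ σ : ℝ, 0 < σ → σ < 1 → χ.LFunction σ ≠ 0 :=
  good_odd_of_eight_blk [3, 409] (by norm_num) (by decide) (by decide) 17 7 103 10 (by decide) (by decide) (by decide)
    (Or.inl (by decide +kernel)) (Or.inr (by decide +kernel))

set_option maxHeartbeats 400000 in
/-- `D = -9832`: the odd character `χ₋₈·(·/1229)` of conductor `9832` (`1229`: prime) — Fekete–Pólya witness of order `6` along the induced modulus `9832·21 = 206472`, block certificate (digits of `90` bits, splitting depth `10`); est. `6.1` kernel-s. [cite: MontgomeryVaughan2007, §11.2.1 Exercises 7 (g), 8] -/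
theorem noRealZeroOdd_fp_9832 :
    ∀ χ : DirichletCharacter ℂ 9832, χ.IsQuadratic → χ.IsPrimitive → χ.Odd →
      ∀ σ : ℝ, 0 < σ → σ < 1 → χ.LFunction σ ≠ 0 :=
  good_odd_of_eight_blk [1229] (by norm_num) (by decide) (by decide) 21 6 90 10 (by decide) (by decide) (by decide)
    (Or.inr (by decide +kernel)) (Or.inl (by decide +kernel))

set_option maxHeartbeats 400000 in
/-- `D = -9867`: the odd character `(·/9867)` of conductor `9867` (`9867`: 3 · 11 · 13 · 23) — Fekete–Pólya witness of order `4` along the induced modulus `9867·35 = 345345`, block certificate (digits of `61` bits, splitting depth `10`); est. `4.6` kernel-s. [cite: MontgomeryVaughan2007, §11.2.1 Exercises 7 (g), 8] -/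
theorem noRealZeroOdd_fp_9867 :
    ∀ χ : DirichletCharacter ℂ 9867, χ.IsQuadratic → χ.IsPrimitive → χ.Odd →
      ∀ σ : ℝ, 0 < σ → σ < 1 → χ.LFunction σ ≠ 0 :=
  good_odd_of_odd_blk [3, 11, 13, 23] (by norm_num) (by decide) (by decide) 35 4 61 10 (by decide) (by decide) (by decide)
    (Or.inr (by decide +kernel))

set_option maxHeartbeats 400000 in
/-- `D = -9899`: the odd character `(·/9899)` of conductor `9899` (`9899`: 19 · 521) — Fekete–Pólya witness of order `8` along the induced modulus `9899·13 = 128687`, block certificate (digits of `114` bits, splitting depth `9`); est. `5.6` kernel-s. [cite: MontgomeryVaughan2007, §11.2.1 Exercises 7 (g), 8] -/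
theorem noRealZeroOdd_fp_9899 :
    ∀ χ : DirichletCharacter ℂ 9899, χ.IsQuadratic → χ.IsPrimitive → χ.Odd →
      ∀ σ : ℝ, 0 < σ → σ < 1 → χ.LFunction σ ≠ 0 :=
  good_odd_of_odd_blk [19, 521] (by norm_num) (by decide) (by decide) 13 8 114 9 (by decide) (by decide) (by decide)
    (Or.inr (by decide +kernel))

set_option maxHeartbeats 400000 in
/-- `D = -9960`: the odd character `χ₋₈·(·/1245)` of conductor `9960` (`1245`: 3 · 5 · 83) — Fekete–Pólya witness of order `8` along the induced modulus `9960·11 = 109560`, block certificate (digits of `113` bits, splitting depth `9`); est. `4.7` kernel-s. [cite: MontgomeryVaughan2007, §11.2.1 Exercises 7 (g), 8] -/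
theorem noRealZeroOdd_fp_9960 :
    ∀ χ : DirichletCharacter ℂ 9960, χ.IsQuadratic → χ.IsPrimitive → χ.Odd →
      ∀ σ : ℝ, 0 < σ → σ < 1 → χ.LFunction σ ≠ 0 :=
  good_odd_of_eight_blk [3, 5, 83] (by norm_num) (by decide) (by decide) 11 8 113 9 (by decide) (by decide) (by decide)
    (Or.inr (by decide +kernel)) (Or.inl (by decide +kernel))

set_option maxHeartbeats 400000 in
/-- `D = -9967`: the odd character `(·/9967)` of conductor `9967` (`9967`: prime) — Fekete–Pólya witness of order `7` along the induced modulus `9967·11 = 109637`, block certificate (digits of `99` bits, splitting depth `9`); est. `4.5` kernel-s. [cite: MontgomeryVaughan2007, §11.2.1 Exercises 7 (g), 8] -/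
theorem noRealZeroOdd_fp_9967 :
    ∀ χ : DirichletCharacter ℂ 9967, χ.IsQuadratic → χ.IsPrimitive → χ.Odd →
      ∀ σ : ℝ, 0 < σ → σ < 1 → χ.LFunction σ ≠ 0 :=
  good_odd_of_odd_blk [9967] (by norm_num) (by decide) (by decide) 11 7 99 9 (by decide) (by decide) (by decide)
    (Or.inr (by decide +kernel))

set_option maxHeartbeats 400000 in
/-- `D = -10036`: the odd character `χ₋₄·(·/2509)` of conductor `10036` (`2509`: 13 · 193) — Fekete–Pólya witness of order `5` along the induced modulus `10036·33 = 331188`, block certificate (digits of `78` bits, splitting depth `11`); est. `8.0` kernel-s. [cite: MontgomeryVaughan2007, §11.2.1 Exercises 7 (g), 8] -/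
theorem noRealZeroOdd_fp_10036 :
    ∀ χ : DirichletCharacter ℂ 10036, χ.IsQuadratic → χ.IsPrimitive → χ.Odd →
      ∀ σ : ℝ, 0 < σ → σ < 1 → χ.LFunction σ ≠ 0 :=
  good_odd_of_four_blk [13, 193] (by norm_num) (by decide) (by decide) 33 5 78 11 (by decide) (by decide) (by decide)
    (Or.inr (by decide +kernel))

set_option maxHeartbeats 400000 in
/-- `D = -10059`: the odd character `(·/10059)` of conductor `10059` (`10059`: 3 · 7 · 479) — Fekete–Pólya witness of order `7` along the induced modulus `10059·22 = 221298`, block certificate (digits of `106` bits, splitting depth `10`); est. `8.1` kernel-s. [cite: MontgomeryVaughan2007, §11.2.1 Exercises 7 (g), 8] -/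
theorem noRealZeroOdd_fp_10059 :
    ∀ χ : DirichletCharacter ℂ 10059, χ.IsQuadratic → χ.IsPrimitive → χ.Odd →
      ∀ σ : ℝ, 0 < σ → σ < 1 → χ.LFunction σ ≠ 0 :=
  good_odd_of_odd_blk [3, 7, 479] (by norm_num) (by decide) (by decide) 22 7 106 10 (by decide) (by decide) (by decide)
    (Or.inr (by decide +kernel))

end Literature.NumberTheory.LFunctions
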